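import Summits.BirchSwinnertonDyer.BirchSwinnertonDyer.Theorems.CyclotomicUntwistConjugateLFunctionsThree
import Mathlib.Topology.Algebra.Module.FiniteDimension
import HarnessLib

/-!
# The Amice transform of the untwisted `p`-adic `L`-function has coefficients in the coefficient field, and
# conjugate `L`-functions have `σ`-CONJUGATE Mahler coefficients: `c_k(𝓛^{η̄}_W) = σ c_k(𝓛^{η}_W)` exactly

Cell `pub/bsd-wall` (D-0145 line `route-BirchSwinnertonDyer-CyclotomicUntwist`), width seat
`bsd-line-cycu-p5` g5. THEOREMS ONLY (no definition, no named fact, no `sorry`); helper `--supports`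
K1 = stmt-BirchSwinnertonDyer-21580 (`PSRankOneLowerHalfAtThree`). BSD is not proved by this file and no
crux of the route is proved by it; K1/K2 stay open and WHOLE.

WHAT. `CyclotomicUntwistConjugateLFunctions{,Three}` proved that conjugate untwisted `L`-functions have Mahler
coefficients of EQUAL NORM. Here the statement is sharpened to an EQUALITY of coefficients after conjugation —
Mazur–Tate–Teitelbaum §I.13's "`L_p(g, T) ∈ ℚ_p(α)⟦T⟧`" together with its Galois behaviour:

* §1 (general prime `p`, coefficient field `K`, `ι : K →+* ℂ_p` with CLOSED range):
  `exists_gammaMahlerCoeff_eq_map` — for an additive `ι ∘ μ_K` of growth order `ν < 1`, every Mahler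
  coefficient `c_k(ι ∘ μ_K)` lies in `ι(K)` (it is the limit of the `ι`-images of the `K`-rational Riemann sums,
  D1 `tendsto_gammaRiemannSum_gammaMahlerCoeff`, and `ι(K)` is closed); `gammaMahlerCoeff_map_eq_of_eq` — for a
  second `ι' : K →+* ℂ_p` with `‖ι' ·‖ = ‖ι ·‖`: `c_k(ι ∘ μ_K) = ι c ⟹ c_k(ι' ∘ μ_K) = ι' c` (the Riemann sums
  converge to `ι' c` because `‖ι'(r_n − c)‖ = ‖ι(r_n − c)‖ → 0`); `gammaLeadingCoeff_map_eq_of_eq`.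
* §2 `isClosed_range_algHom` — the range of a `ℚ_p`-embedding of a FINITE extension `K/ℚ_p` into `ℂ_p` is closed
  (a finite-dimensional subspace of a normed space over a complete field; Mathlib
  `Submodule.closed_of_finiteDimensional`).
* §3 (`p = 3`, `K = ℚ₃(ζ₃)`): **`exists_conj_gammaMahlerCoeff_of_isPSCyclotomicLFunctionOf`** — for `μ = 𝓛^{η}_W`
  (datum `(η_K ∘ ι, ι α_K)`, `η_K` primitive mod `9`, `η_K ∘ σ = η_K⁻¹`, `α_K ∉ {0, 3}`): there are `μ_K` and
  `c : ℕ → ℚ₃(ζ₃)` with `μ = ι ∘ μ_K`, `c_k(μ) = ι (c k)` for all `k` (the Amice transform of `𝓛^{η}_W` has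
  coefficients in `ℚ₃(ζ₃)`), and the conjugate `L`-function `𝓛^{η̄}_W = ι ∘ σ ∘ μ_K` (file `…Three`) has
  `c_k(𝓛^{η̄}_W) = ι (σ (c k))` — its Amice transform is the `σ`-CONJUGATE power series — with the same order at
  `𝟙` and `σ`-conjugate leading coefficients; granted Carayol (`hlev`), `conj_gammaMahlerCoeff_of_isPSCyclotomicLFunctionOf`
  says the same for ANY `𝓛^{η̄}_W`.

WHY (route bookkeeping). With D2's `h_ψ̄ = σ h_ψ` (`PSLineHeightData.conj`): the crux GZ₃ of K1's separated closer
(`c₁(𝓛^η_W) = κ_an · q · ι h_ψ(P,P)`) for the pair `(η, ψ)` is EQUIVALENT to GZ₃ for `(η̄, ψ̄)` with the constant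
`σ κ_an` — one line suffices, and any proposed D4 constant must transform by `σ`; likewise pBSD₃ and MATCH.

References: [cite: MazurTateTeitelbaum1986Invent, §I.10 and §I.13 (rationality of L_p(g,T))] ·
[cite: Bellaiche2021, Thm. 6.2.13] · [cite: BoschGuntzerRemmert1984, §3.2.4 Thm. 2].
-/

noncomputable section

open scoped MatrixGroups

open Filter Topology CongruenceSubgroup DirichletCharacter Literature.NumberTheory.EllipticCurves
  Literature.NumberTheory.EllipticCurves.ModularForms Literature.NumberTheory.IwasawaTheory
  Summit.BirchSwinnertonDyer.BirchSwinnertonDyer.Theorems.PSCandidateUniqueness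
  Summit.BirchSwinnertonDyer.BirchSwinnertonDyer.Theorems.PSConjugateLFunctions
  Summit.BirchSwinnertonDyer.BirchSwinnertonDyer.Theorems.PSConjugateLFunctionsThree

-- single-conjunct summit: `Summit.BirchSwinnertonDyer.BirchSwinnertonDyer.…` repeats the name by design
set_option linter.dupNamespace false
set_option autoImplicit false

namespace Summit.BirchSwinnertonDyer.BirchSwinnertonDyer.Theorems.PSAmiceRationality

variable {p : ℕ} [Fact p.Prime]

/-! ### §1 Mahler coefficients of `ι ∘ μ_K` lie in `ι(K)` (closed range) and conjugate exactly -/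

section General

variable {K : Type*} [Field K] (ι ι' : K →+* ℂ_[p]) (μK : (n : ℕ) → ZMod (p ^ n) → K)

/-- **Rationality of the Mahler coefficients.** If `ι(K) ⊆ ℂ_p` is closed and `ι ∘ μ_K` is additive of
growth order `ν < 1`, every Mahler coefficient `c_k(ι ∘ μ_K)` is `ι c` for some `c ∈ K` (limit of the
`ι`-images of `K`-rational Riemann sums). [cite: MazurTateTeitelbaum1986Invent, §I.13] [cite: Bellaiche2021, Thm. 6.2.13] -/
theorem exists_gammaMahlerCoeff_eq_map (hclosed : IsClosed (Set.range ι))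
    (hadd : IsGammaDistribution p (fun n s ↦ ι (μK n s))) {ν : ℝ}
    (hgr : HasGrowthOrder p ν (fun n s ↦ ι (μK n s))) (hν : ν < 1) (k : ℕ) :
    ∃ c : K, gammaMahlerCoeff p (fun n s ↦ ι (μK n s)) k = ι c := by
  have ht := tendsto_gammaRiemannSum_gammaMahlerCoeff hadd hgr hν k
  have hmem : ∀ n, gammaRiemannSum p (fun n s ↦ ι (μK n s)) (fun a ↦ ((a.choose k : ℕ) : ℂ_[p])) n ∈
      Set.range ι :=
    fun n ↦ ⟨_, (gammaRiemannSum_map_choose ι μK k n).symm⟩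
  obtain ⟨c, hc⟩ := hclosed.mem_of_tendsto ht (Eventually.of_forall hmem)
  exact ⟨c, hc.symm⟩

/-- **Exact conjugation of a Mahler coefficient.** With `‖ι' ·‖ = ‖ι ·‖` on `K` and `ι ∘ μ_K` additive of
growth order `ν < 1`: if `c_k(ι ∘ μ_K) = ι c` then `c_k(ι' ∘ μ_K) = ι' c`. [cite: MazurTateTeitelbaum1986Invent, §I.13] [cite: BoschGuntzerRemmert1984, §3.2.4 Thm. 2] -/
theorem gammaMahlerCoeff_map_eq_of_eq (hnorm : ∀ x : K, ‖ι' x‖ = ‖ι x‖)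
    (hadd : IsGammaDistribution p (fun n s ↦ ι (μK n s))) {ν : ℝ}
    (hgr : HasGrowthOrder p ν (fun n s ↦ ι (μK n s))) (hν : ν < 1) {k : ℕ} {c : K}
    (hc : gammaMahlerCoeff p (fun n s ↦ ι (μK n s)) k = ι c) :
    gammaMahlerCoeff p (fun n s ↦ ι' (μK n s)) k = ι' c := by
  have ht := tendsto_gammaRiemannSum_gammaMahlerCoeff hadd hgr hν k
  have ht' := tendsto_gammaRiemannSum_gammaMahlerCoeff (isGammaDistribution_map ι ι' μK hadd)
    (hasGrowthOrder_map ι ι' μK hnorm hgr) hν k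
  rw [hc] at ht
  -- the `ι'`-Riemann sums converge to `ι' c`
  have h2 : Tendsto (gammaRiemannSum p (fun n s ↦ ι' (μK n s)) (fun a ↦ ((a.choose k : ℕ) : ℂ_[p])))
      atTop (𝓝 (ι' c)) := by
    rw [tendsto_iff_norm_sub_tendsto_zero] at ht ⊢
    refine ht.congr fun n ↦ ?_
    rw [gammaRiemannSum_map_choose ι, gammaRiemannSum_map_choose ι', ← map_sub, ← map_sub, hnorm]
  exact tendsto_nhds_unique ht' h2

/-- **Exact conjugation of the leading coefficient at `𝟙`**: same order (file `…ConjugateLFunctions`) and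
`lead(ι' ∘ μ_K) = ι' ℓ` when `lead(ι ∘ μ_K) = ι ℓ`. [cite: MazurTateTeitelbaum1986Invent, §I.13] -/
theorem gammaLeadingCoeff_map_eq_of_eq (hnorm : ∀ x : K, ‖ι' x‖ = ‖ι x‖)
    (hadd : IsGammaDistribution p (fun n s ↦ ι (μK n s))) {ν : ℝ}
    (hgr : HasGrowthOrder p ν (fun n s ↦ ι (μK n s))) (hν : ν < 1) {ℓ : K}
    (hℓ : gammaLeadingCoeff p (fun n s ↦ ι (μK n s)) = ι ℓ) :
    gammaLeadingCoeff p (fun n s ↦ ι' (μK n s)) = ι' ℓ := by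
  rw [gammaLeadingCoeff_def, gammaOrderAtOne_map ι ι' μK hnorm hadd hgr hν, coeff_gammaAmiceTransform]
  rw [gammaLeadingCoeff_def, coeff_gammaAmiceTransform] at hℓ
  exact gammaMahlerCoeff_map_eq_of_eq ι ι' μK hnorm hadd hgr hν hℓ

/-- **All coefficients at once**: with closed `ι(K)`, there is `c : ℕ → K` with `c_k(ι ∘ μ_K) = ι (c k)` and
`c_k(ι' ∘ μ_K) = ι' (c k)` for every `k` — the two Amice transforms are the `ι`- and `ι'`-images of ONE power
series over `K`. [cite: MazurTateTeitelbaum1986Invent, §I.13] [cite: BoschGuntzerRemmert1984, §3.2.4 Thm. 2] -/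
theorem exists_gammaMahlerCoeff_eq_map_and_map (hclosed : IsClosed (Set.range ι))
    (hnorm : ∀ x : K, ‖ι' x‖ = ‖ι x‖) (hadd : IsGammaDistribution p (fun n s ↦ ι (μK n s))) {ν : ℝ}
    (hgr : HasGrowthOrder p ν (fun n s ↦ ι (μK n s))) (hν : ν < 1) :
    ∃ c : ℕ → K, ∀ k : ℕ, gammaMahlerCoeff p (fun n s ↦ ι (μK n s)) k = ι (c k) ∧
      gammaMahlerCoeff p (fun n s ↦ ι' (μK n s)) k = ι' (c k) := by
  choose c hc using exists_gammaMahlerCoeff_eq_map ι μK hclosed hadd hgr hν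
  exact ⟨c, fun k ↦ ⟨hc k, gammaMahlerCoeff_map_eq_of_eq ι ι' μK hnorm hadd hgr hν (hc k)⟩⟩

end General

/-! ### §2 A `ℚ_p`-embedding of a finite extension has closed range in `ℂ_p` -/

section Closed

variable {K : Type*} [Field K] [Algebra ℚ_[p] K] [FiniteDimensional ℚ_[p] K]

/-- **`ι(K)` is closed in `ℂ_p`** for `K/ℚ_p` finite and `ι : K →ₐ[ℚ_p] ℂ_p`: it is a finite-dimensional
`ℚ_p`-subspace (Mathlib `Submodule.closed_of_finiteDimensional`, `ℚ_p` complete). [folklore] -/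
theorem isClosed_range_algHom (ι : K →ₐ[ℚ_[p]] ℂ_[p]) :
    IsClosed (Set.range (ι : K →+* ℂ_[p])) := by
  have h : Set.range (ι : K →+* ℂ_[p]) = (LinearMap.range ι.toLinearMap : Set ℂ_[p]) := by
    ext x
    simp only [Set.mem_range, SetLike.mem_coe, LinearMap.mem_range, AlgHom.toLinearMap_apply]
    rfl
  rw [h]
  exact Submodule.closed_of_finiteDimensional _

end Closed

/-! ### §3 `p = 3`, `K = ℚ₃(ζ₃)`: the Amice transforms of `𝓛^{η}_W` and `𝓛^{η̄}_W` are `σ`-conjugate -/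

section Curve

variable {W : WeierstrassCurve ℚ}
  (ι : CyclotomicField 3 ℚ_[3] →ₐ[ℚ_[3]] ℂ_[3])
  (ηK : DirichletCharacter (CyclotomicField 3 ℚ_[3]) (3 ^ 2)) (αK : CyclotomicField 3 ℚ_[3])
  (σ : CyclotomicField 3 ℚ_[3] ≃ₐ[ℚ_[3]] CyclotomicField 3 ℚ_[3])

/-- **`σ`-CONJUGATE AMICE TRANSFORMS (no Carayol).** For `W/ℚ`, `ι : ℚ₃(ζ₃) →ₐ[ℚ₃] ℂ₃`, `σ ∈ Aut(ℚ₃(ζ₃)/ℚ₃)`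
with `η_K ∘ σ = η_K⁻¹`, `η_K` primitive mod `9`, `α_K ∉ {0, 3}` and `μ = 𝓛^{η}_W` (datum `(η_K ∘ ι, ι α_K)`):
there are `μ_K` and `c : ℕ → ℚ₃(ζ₃)` with `μ = ι ∘ μ_K`, the conjugate `L`-function `ι ∘ σ ∘ μ_K` is
`IsPSCyclotomicLFunctionOf W (η_K ∘ ι)⁻¹ (ι (σ α_K))`, and for every `k`:
`c_k(μ) = ι (c k)` and `c_k(ι ∘ σ ∘ μ_K) = ι (σ (c k))` — the Amice transform of `𝓛^{η}_W` has coefficients in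
`ℚ₃(ζ₃)` and that of `𝓛^{η̄}_W` is its `σ`-conjugate; the orders at `𝟙` agree and the leading coefficients are
`σ`-conjugate. [cite: MazurTateTeitelbaum1986Invent, §I.10 and §I.13] [cite: BoschGuntzerRemmert1984, §3.2.4 Thm. 2] -/
theorem exists_conj_gammaMahlerCoeff_of_isPSCyclotomicLFunctionOf
    (hσ : ηK.ringHomComp (σ : CyclotomicField 3 ℚ_[3] →+* CyclotomicField 3 ℚ_[3]) = ηK⁻¹)
    (hη : ηK.IsPrimitive) (hα : αK ≠ 0) (hα3 : αK ≠ (3 : ℕ)) {μ : (n : ℕ) → ZMod (3 ^ n) → ℂ_[3]}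
    (hμ : IsPSCyclotomicLFunctionOf W (ηK.ringHomComp (ι : CyclotomicField 3 ℚ_[3] →+* ℂ_[3])) (ι αK) μ) :
    ∃ (μK : (n : ℕ) → ZMod (3 ^ n) → CyclotomicField 3 ℚ_[3]) (c : ℕ → CyclotomicField 3 ℚ_[3])
      (ℓ : CyclotomicField 3 ℚ_[3]),
      (μ = fun n s ↦ ι (μK n s)) ∧
      IsPSCyclotomicLFunctionOf W (ηK.ringHomComp (ι : CyclotomicField 3 ℚ_[3] →+* ℂ_[3]))⁻¹ (ι (σ αK))
        (fun n s ↦ ι (σ (μK n s))) ∧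
      (∀ k : ℕ, gammaMahlerCoeff 3 μ k = ι (c k) ∧
        gammaMahlerCoeff 3 (fun n s ↦ ι (σ (μK n s))) k = ι (σ (c k))) ∧
      gammaOrderAtOne 3 (fun n s ↦ ι (σ (μK n s))) = gammaOrderAtOne 3 μ ∧
      gammaLeadingCoeff 3 μ = ι ℓ ∧ gammaLeadingCoeff 3 (fun n s ↦ ι (σ (μK n s))) = ι (σ ℓ) := by
  haveI : Module.Finite ℚ_[3] (CyclotomicField 3 ℚ_[3]) :=
    IsCyclotomicExtension.finite {3} ℚ_[3] (CyclotomicField 3 ℚ_[3])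
  haveI : Algebra.IsAlgebraic ℚ_[3] (CyclotomicField 3 ℚ_[3]) :=
    Algebra.IsAlgebraic.of_finite ℚ_[3] (CyclotomicField 3 ℚ_[3])
  have hag := hμ.isGammaDistribution_and_hasGrowthOrder
  obtain ⟨μK, hμK, hPS, -, -, hord, -⟩ :=
    exists_conjugate_of_isPSCyclotomicLFunctionOf ι ηK αK σ hσ hη hα hα3 hμ
  set ι₀ : CyclotomicField 3 ℚ_[3] →+* ℂ_[3] := (ι : CyclotomicField 3 ℚ_[3] →+* ℂ_[3]) with hι₀
  set ι₁ : CyclotomicField 3 ℚ_[3] →+* ℂ_[3] :=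
    (((ι.comp (σ : CyclotomicField 3 ℚ_[3] →ₐ[ℚ_[3]] CyclotomicField 3 ℚ_[3])) :
      CyclotomicField 3 ℚ_[3] →ₐ[ℚ_[3]] ℂ_[3]) : CyclotomicField 3 ℚ_[3] →+* ℂ_[3]) with hι₁
  have e₀ : μ = fun n s ↦ ι₀ (μK n s) := hμK
  have e₁ : (fun n (s : ZMod (3 ^ n)) ↦ ι (σ (μK n s))) = fun n s ↦ ι₁ (μK n s) := rfl
  have hn : ∀ x : CyclotomicField 3 ℚ_[3], ‖ι₁ x‖ = ‖ι₀ x‖ := fun x ↦ norm_algHom_algEquiv ι σ x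
  have hag₀ : IsGammaDistribution 3 (fun n s ↦ ι₀ (μK n s)) ∧
      HasGrowthOrder 3 (1 / 2) (fun n s ↦ ι₀ (μK n s)) := e₀ ▸ hag
  have h12 : (1 / 2 : ℝ) < 1 := by norm_num
  have hcl : IsClosed (Set.range ι₀) := isClosed_range_algHom (p := 3) ι
  obtain ⟨c, hc⟩ := exists_gammaMahlerCoeff_eq_map_and_map ι₀ ι₁ μK hcl hn hag₀.1 hag₀.2 h12
  -- the leading coefficient: order `r` (finite or not, `toNat` handles both) and `c_r`
  refine ⟨μK, c, c (gammaOrderAtOne 3 μ).toNat, hμK, hPS, ?_, hord, ?_, ?_⟩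
  · intro k
    rw [e₀, e₁]
    exact hc k
  · rw [gammaLeadingCoeff_def, coeff_gammaAmiceTransform, e₀]
    exact (hc _).1
  · rw [gammaLeadingCoeff_def, coeff_gammaAmiceTransform, hord, e₀, e₁]
    exact (hc _).2

/-- **Granted Carayol (`hlev`): ANY `𝓛^{η̄}_W` has the `σ`-conjugate Amice transform of `𝓛^{η}_W`.** For `μ`,
`μ'` the untwisted `L`-functions of the data `(η_K ∘ ι, ι α_K)` and `((η_K ∘ ι)⁻¹, ι (σ α_K))`: there is
`c : ℕ → ℚ₃(ζ₃)` with `c_k(μ) = ι (c k)` and `c_k(μ') = ι (σ (c k))` for every `k`.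
[cite: MazurTateTeitelbaum1986Invent, §I.10 and §I.13] [cite: Carayol1986] -/
theorem conj_gammaMahlerCoeff_of_isPSCyclotomicLFunctionOf [W.IsElliptic]
    (hlev : ∀ (M : ℕ) [NeZero M], IsNewformOf.level_eq_conductorNorm (N := M))
    (hσ : ηK.ringHomComp (σ : CyclotomicField 3 ℚ_[3] →+* CyclotomicField 3 ℚ_[3]) = ηK⁻¹)
    (hη : ηK.IsPrimitive) (hα : αK ≠ 0) (hα3 : αK ≠ (3 : ℕ))
    {μ μ' : (n : ℕ) → ZMod (3 ^ n) → ℂ_[3]}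
    (hμ : IsPSCyclotomicLFunctionOf W (ηK.ringHomComp (ι : CyclotomicField 3 ℚ_[3] →+* ℂ_[3])) (ι αK) μ)
    (hμ' : IsPSCyclotomicLFunctionOf W (ηK.ringHomComp (ι : CyclotomicField 3 ℚ_[3] →+* ℂ_[3]))⁻¹
      (ι (σ αK)) μ') :
    ∃ c : ℕ → CyclotomicField 3 ℚ_[3], ∀ k : ℕ,
      gammaMahlerCoeff 3 μ k = ι (c k) ∧ gammaMahlerCoeff 3 μ' k = ι (σ (c k)) := by
  obtain ⟨μK, c, -, hμK, hPS, hc, -⟩ :=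
    exists_conj_gammaMahlerCoeff_of_isPSCyclotomicLFunctionOf ι ηK αK σ hσ hη hα hα3 hμ
  obtain rfl : μ' = fun n s ↦ ι (σ (μK n s)) := PSGammaUniqueness.eq_of_isPSCyclotomicLFunctionOf hlev hμ' hPS
  exact ⟨c, hc⟩

end Curve

end Summit.BirchSwinnertonDyer.BirchSwinnertonDyer.Theorems.PSAmiceRationality

end
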